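import Literature.MathematicalPhysics.QuantumFieldTheory.Balaban1983to89.B9

/-!
# `Balaban1983to89.B9Eq380Telescope` — B9, p. 406: «From (3.78) it follows … (3.80)» and «(143) [5] implies the following
# bound (3.81)» MADE HONEST: the telescoping identity that turns the product structure (3.78) of the averaging operator
# `Q_j(U′U)` and the one-step splitting `Q(exp iBV) = Q(V) + F₂(B)` into `Q_j(U′U) = Q_j(U) + F_{2,j}(A)` with `F_{2,j}(A)`
# EXPLICIT (the last slot has `n` factors, `Q_n(U′U)` — the print's `Q_{n−1}(U′U)` is an index slip, kernel witness), its
# ascending twin for `Q*_j(U′U)`, and (3.81) as a norm bound with every `O(1)` explicit; kernel-checked; v1.1 (v1 = p192580; v1.1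
# docstring only: the two render-limited glyph queries of XREAD adv9-g69 (journal l.59190, D-1/D-2 LOW) settled on the x4 render —
# (3.78) second line, penultimate factor prints «Q(ŨŪ)» (no prime) and (3.81) first line prints the constant as «0(1)»; both now
# quoted verbatim with [sic]; no declaration, statement or proof changed)

CITATION HEADER (lean-in-tree rule).  Audit cell `pub-balaban`, surge node-prover lineage pv27 (B9 §3: expansions of the
operators of the effective action in the fluctuation field `A` around the background `U`, pp. 404–406), unit
`b2b-balaban-pv27-g19` (journal CLAIM l.58847, node B9-EQ380-TELESCOPE; fourth node of the seat, after `B9Eq375Composition`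
(p191250/p191719), `B9Eq375Locality` (p191610/p191722), `B9Eq372Operator` (p192240/p192387)).  B9 = T. Bałaban, *Propagators for
lattice gauge theories in a background field*, Commun. Math. Phys. **99**, 389–434 (1985) [Balaban1985BackgroundPropagators]
(journal page = PDF page + 388); «[5]» of B9 = B7 = T. Bałaban, *Averaging operations for lattice gauge theories*, Commun. Math.
Phys. **98**, 17–51 (1985) [Balaban1985Averaging].  Every quotation below was read by this seat (2026-08-19) from the x2 page
render `b2b-balaban-ref1/pages/1985-cmp99-background-propagators/1985-cmp99-background-propagators-p018-x2.png` (p. 406) AS AN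
IMAGE, not from an OCR layer; (v1.1) the two glyphs queried by the cross-read — the penultimate factor of the second line of
(3.78) and the constant of the first line of (3.81) — were re-read on the x4 render `…-p018-x4.png` (unit `b2b-balaban-pv27-g20`,
×5 crops): the factor prints «Q(ŨŪ)» with the prime of `Ũ′` absent (the first factor of the same line prints «Ũ′^{j−1}Ū^{j−1}»
with it; consistency with `\overline{U′U}^1 = Ũ′^1Ū^1` wants `Q(Ũ′Ū)`), and the constant is the upright glyph «0(1)» (as in
«|B_n| < 0(1)…» and (3.79); the second line of (3.81) prints the italic «O(1)»).  What is reproduced: ONLY the bookkeeping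
the two sentences «From (3.78) if [sic] follows that … and we have (3.80)» and «The inequality (143) [5] implies the following
bound (3.81)» rely on — a telescoping identity for
products in a ring and the triangle/submultiplicativity estimate along it —, with the analytic inputs (B7 Proposition 6, the
formula (124) and the inequalities (142)–(143) of [5], (3.79), the size of `B_n`) as HYPOTHESES (binders), never as facts.

ABSOLUTE RULE of the cell, honoured: no internally-minted statement enters as a cited fact.  Every declaration below is PROVED
(`[folklore]`: elementary algebra/analysis once the letters are fixed; the `[cite: …]` tags are LOCATORS of the printed
sentence a declaration makes honest, not appeals to it).  Nothing of `B9Eq319Avg` (b09: the averaging operator `Q′` of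
(3.18)–(3.19)) or of the B7 files (`B7Prop5Flat`, `B7Prop6Flat`, `B7Ineq148`, …: (140)–(143) in the flat background) is
imported or restated; `B9.eq381_scale_sum` (b09, GAPS C-B9-9: `Σ_{n<j} L^n/L^j ≤ 1/(L − 1)`) is USED BY NAME.

WHAT IS IN PRINT (p. 406 [PDF 18], verbatim; `Ū^n`, `Ũ′^n` = the `n`-fold averaged configurations, `\overline{U′U}^n` the
`n`-fold average of `U′U`).  «Finally we consider the averaging operator Q(U). It coincides with Q_j(U) on B^j(Λ_j), and
Q_j(U′U) is given by the product  Q_j(U′U) = Q(\overline{U′U}^{j−1})·…·Q(\overline{U′U})Q(U′U)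
= Q(Ũ′^{j−1}Ū^{j−1})·…·Q(ŨŪ)Q(U′U) [sic: Q(Ũ′Ū) — the prime is absent in print on this one factor].  (3.78)  By Proposition 6 [5]
the averages Ũ′^n, n = j − 1, ⋯, 0, are analytic functions of A on configurations satisfying the first inequality in (3.37),
i.e. |A| < α₁ (L^jη)⁻¹ on B^j(Λ_j). Denoting Ũ′^n = exp iB_n, we have |B_n| < 0(1)α₁L^nξ [sic: O(1)],
ξ = L^{−j}. It follows from the explicit formula (124) [5] that the averaging operator Q(exp iBV) is an analytic function of B,
for B sufficiently small. Moreover this formula implies easily that  Q(exp iBV) = Q(V) + F₂(B),  and  |F₂(B)B′| ≤ 0(1)sup|B|Q″|B′|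
[sic: O(1)], (3.79)  where the averages Q″, Q″_j were introduced in [5] by the formulas (140), (141). The constant O(1) above
depends only on d and L. From (3.78) if [sic] follows that Q_j(U′U) depends analytically on A in the above domain, and we have
Q_j(U′U) = Q_j(U) + Σ_{n=0}^{j−1} Q(Ū^{j−1})·…·Q(Ū^{n+1}) · F₂(B_n)Q(Ũ′^{n−1}Ū^{n−1})·…·Q(U′U)
         = Q_j(U) + Σ_{n=0}^{j−1} Q_{j−1−n}(Ū^{n+1})F₂(B_n)Q_{n−1}(U′U) = Q_j(U) + F_{2,j}(A),  (3.80)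
where F_{2,j} is defined by the last equality. It is of course analytic in A. The inequality (143) [5] implies the following
bound  |F_{2,j}(A)A′| ≤ Σ_{n=0}^{j−1} 0(1)Q″_{j−1−n}α₁L^nξQ″Q″_{n−1}|A′| [sic: O(1)] ≤ O(1)α₁Q″_j|A′|  on Λ_j,  (3.81)  for Mα₀, α₁
sufficiently small and with a constant O(1) depending on d and L only.  We have a similar expansion for Q*_j(U′U), i.e. Q*_j(U′U) = Q*_j(U) +
F*_{2,j}(A), and F*_{2,j}(A) satisfies (3.81). (Let us notice that for complex configurations A the operator F*_{2,j}(A) is not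
the adjoint of F_{2,j}(A).)»

READING / MODEL.  The `j` one-step averaging operators act between the function spaces of successive lattices
`ηℤ^d ⊃ Lηℤ^d ⊃ … ⊃ L^jηℤ^d`; identifying a function on `L^nη`-lattice with the block-constant function on the `η`-lattice, all
of them live in ONE algebra of operators, and (3.78) says that `Q_j(U′U)` is the DESCENDING PRODUCT `x_{j−1}⋯x_1x_0` of the
factors `x_n := Q(\overline{U′U}^n) = Q(Ũ′^nŪ^n) = Q(exp(iB_n)Ū^n)`, while `Q_j(U) = a_{j−1}⋯a_0`, `a_n := Q(Ū^n)`; the splitting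
«Q(exp iBV) = Q(V) + F₂(B)» is `x_n = a_n + f_n`, `f_n := F₂(B_n)`.  This file therefore works with three sequences `x a f : ℕ → R`
in a ring `R` (a monoid for §1; a normed ring for §4; continuous linear operators on a normed space for §5) — every `Q(·)`,
`F₂(·)` is a BINDER, and so is every majorant constant (`Q″`, `Q″_n`, the `O(1)`'s, the size `β_n` of `B_n`).  COUNTING FACTORS:
by (3.78), `Q_j(U′U)` has `j` factors at the levels `j−1, …, 0`; in the first line of (3.80) the prefix «Q(Ū^{j−1})·…·Q(Ū^{n+1})»
has `j−1−n` factors (`= Q_{j−1−n}(Ū^{n+1})` in the print's own count-indexing) and the suffix «Q(Ũ′^{n−1}Ū^{n−1})·…·Q(U′U)» has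
`n` factors, i.e. it is `Q_n(U′U)` — the print's second line writes `Q_{n−1}(U′U)` (for `n = 0`: `Q_{−1}`), and (3.81) copies the
index into `Q″_{n−1}`.  The kernel identity below holds with `n` factors (`prodDesc x n`) and FAILS with the literal `n−1`
(`telescope_printed_index_fails`, an integer instance with `j = 2`): this is the index slip already recorded, on the print side,
by the cell's adversarial reader adv8 (GAPS G-adv8-5 (ii), «the displayed bound O(1)α₁Q″_j|A′| is unaffected») — DIVERGENCE
D-pv27.13 (immaterial).

WHAT THIS FILE PROVES (every `O(1)` explicit; no analytic input used).
* §1 PRODUCTS: `prodDesc x j = x_{j−1}⋯x_0`, segments `prodSeg x m k = x_{m+k−1}⋯x_m`, their splitting/concatenation laws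
  (`prodDesc_add`, `prodSeg_add`, `prodSeg_zero_left`, `prodDesc_const`), the ascending versions `prodAsc`, `prodSegAsc` (for the
  adjoint products) and the passage through the opposite monoid (`op_prodDesc`, `op_prodSeg`).
* §2 **(3.78) ⟹ (3.80)**: the telescoping sum **`teleSum a f x j = Σ_{n<j} (a_{j−1}⋯a_{n+1})·f_n·(x_{n−1}⋯x_0)`** (= the
  print's `Σ_n Q_{j−1−n}(Ū^{n+1})F₂(B_n)Q_n(U′U)`, i.e. `F_{2,j}(A)` made explicit), its recursion `teleSum_succ`, and
  **`prodDesc_telescope`**: `x_n = a_n + f_n` for all `n` ⟹ `prodDesc x j = prodDesc a j + teleSum a f x j`, in ANY semiring (no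
  commutativity); in a ring, with `f := x − a` («F₂(B) := Q(exp iBV) − Q(V)», which is what «this formula implies easily» amounts
  to as a definition) NO hypothesis is needed: **`bigF_eq_teleSum`** (`F_{2,j} := Q_j(U′U) − Q_j(U) = teleSum`),
  `prodDesc_eq_add_bigF`; the literal-print variant `teleSumPrinted` (suffix `prodDesc x (n − 1)`) and
  **`telescope_printed_index_fails`** / `telescope_correct_index_example` (over `ℤ`, `j = 2`: product `2`, correct sum `2`,
  literal sum `1`).
* §3 THE ASCENDING TWIN («a similar expansion for Q*_j(U′U)»): `teleSumAsc`, `teleSumAsc_succ`, **`prodAsc_telescope`**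
  (`y_n = b_n + g_n` ⟹ `y_0⋯y_{j−1} = b_0⋯b_{j−1} + Σ_{n<j} (y_0⋯y_{n−1})·g_n·(b_{n+1}⋯b_{j−1})`), and in a star ring the adjoint
  laws `star_prodDesc`, `star_prodSeg`, `star_prodAsc`, **`star_teleSum`** (`(F_{2,j})* = Σ_n Q_n(U′U)*F₂(B_n)*Q_{j−1−n}(Ū^{n+1})*`;
  the print's caveat that for complex `A` the operator `F*_{2,j}(A)` is NOT this adjoint is respected: `prodAsc_telescope` is
  stated for arbitrary ascending data, to be fed with the factors of `Q*_j` directly).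
* §4 **(3.81)** in a normed ring (`‖xy‖ ≤ ‖x‖‖y‖`; `‖1‖ = 1` not assumed): `norm_prodDesc_succ_le` (`‖x_n‖ ≤ q` ⟹ `‖x_j⋯x_0‖ ≤
  q^{j+1}`); **`norm_teleSum_le`** — first inequality of (3.81): prefix bounds `‖a_{j−1}⋯a_{n+1}‖ ≤ p_n` («Q″_{j−1−n}»), (3.79)
  as `‖f_n‖ ≤ c₀·β_n·Q″` (`sup|B_n| ≤ β_n`), suffix bounds `‖x_{n−1}⋯x_0‖ ≤ s_n` («Q″_n») ⟹ `‖F_{2,j}‖ ≤ Σ_{n<j} p_n(c₀β_nQ″)s_n`;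
  **`norm_teleSum_le_printed`** — the printed conclusion: with `β_n ≤ c₁α₁L^n/L^j` («|B_n| < O(1)α₁L^nξ»), the (142)-type
  merge `p_n·Q″·s_n ≤ c₂·Q_j` (uniform in `n`) and `B9.eq381_scale_sum`: `‖F_{2,j}‖ ≤ c₀c₁c₂α₁Q_j/(L − 1)` (`L > 1`) — the print's
  `O(1)α₁Q″_j` with `O(1) = c₀c₁c₂/(L − 1)`, «depending on d and L only» granted the same for `c₀, c₁, c₂`.
* §5 THE OPERATOR READING: for continuous linear operators on a normed space, (3.80) applied to a field
  (`prodDesc_telescope_apply`: `Q_j(U′U)A′ = Q_j(U)A′ + F_{2,j}(A)A′`) and (3.81) in the printed vector form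
  (`norm_teleSum_apply_le_printed`: `‖F_{2,j}(A)A′‖ ≤ c₀c₁c₂α₁Q_j/(L − 1)·‖A′‖`).
* §6 SANITY (`example`s): the `j = 3` instance written out; a numeric descending product.

RELATED IN THE TREE, NOT DUPLICATED (searched 2026-08-19: `grep -rln "(3.78)\|(3.80)\|(3.81)\|telescop" Balaban1983to89/`, MODULE-MAP
rows B7/B9): `B9.eq381_scale_sum` (the scale sum of (3.81), C-B9-9 — used by name, not re-proved); `B9` header remarks on
(3.78)–(3.81) (G-B9-02, G-B7-05: B7 Props 6–7 applied to complex `U′U`); GAPS G-A2-1 (the use-site of B7 Prop 6 for `|B_n|`);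
GAPS G-adv8-5 (ii) (the index slip, print side); `B7Prop5Flat`/`B7Ineq148` (`Qpp` = Q″ of (140) and the (142) multiplicity `2d` in
the FLAT background — a different carrier; here Q″-type constants stay real binders).  No file in the directory states the
telescoping identity or (3.80)/(3.81) as theorems.

NOT PROVED HERE (and not claimed): (3.78) itself — the factorisation `\overline{U′U}^n = Ũ′^nŪ^n` (B7 Proposition 6) and the
composition structure of `Q_j` (definitions of the averaging operators: `B9Eq319Avg`, B7); the analyticity statements («are
analytic functions of A», «Q(exp iBV) is an analytic function of B», «It is of course analytic in A»); the formula (124) of [5]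
and (3.79); the bound `|B_n| < O(1)α₁L^nξ` (G-A2-1, conditional on G-B7-05); the majorants Q″, Q″_j of (140)–(141), the merge
(142) and the inequality (143) of [5] (hypotheses `hp`, `hs`, `hmerge` are binders); the domains `Λ_j`, `B^j(Λ_j)` and «Mα₀, α₁
sufficiently small»; that `F*_{2,j}(A)` «satisfies (3.81)» beyond the symmetric restatement; the block-constant identification
of the levels (MODEL above).  NOT summit progress: kernel certificate of one telescoping step of B9 §3's bookkeeping.
-/

open Finset

namespace Literature.MathematicalPhysics.QuantumFieldTheory.Balaban1983to89.B9Eq380Telescope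

/-! ## §1 Descending and segment products (the composition structure of (3.78)) -/

section Products

variable {R : Type*} [Monoid R]

/-- `prodDesc x j = x_{j−1} · … · x_1 · x_0` (`j` factors, highest level leftmost; `prodDesc x 0 = 1`):
the shape of (3.78) «Q_j(U′U) = Q(\overline{U′U}^{j−1})·…·Q(\overline{U′U})Q(U′U)». [folklore] -/
def prodDesc (x : ℕ → R) : ℕ → R
  | 0 => 1
  | j + 1 => x j * prodDesc x j

/-- `prodSeg x m k = x_{m+k−1} · … · x_{m+1} · x_m` (`k` factors starting at level `m`; `prodSeg x m 0 = 1`):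
the shape of «Q(Ū^{j−1})·…·Q(Ū^{n+1})» `= prodSeg a (n+1) (j−1−n)` in (3.80). [folklore] [cite: Balaban1985BackgroundPropagators, (3.80) p.406] -/
def prodSeg (x : ℕ → R) (m : ℕ) : ℕ → R
  | 0 => 1
  | k + 1 => x (m + k) * prodSeg x m k

/-- Empty descending product. [folklore] -/
@[simp] theorem prodDesc_zero (x : ℕ → R) : prodDesc x 0 = 1 := rfl

/-- One more (higher) level on the left: `x_j · (x_{j−1}⋯x_0)`. [folklore] -/
@[simp] theorem prodDesc_succ (x : ℕ → R) (j : ℕ) : prodDesc x (j + 1) = x j * prodDesc x j := rfl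

/-- Empty segment. [folklore] -/
@[simp] theorem prodSeg_zero (x : ℕ → R) (m : ℕ) : prodSeg x m 0 = 1 := rfl

/-- One more level on the left of a segment: `x_{m+k} · (x_{m+k−1}⋯x_m)`. [folklore] -/
@[simp] theorem prodSeg_succ (x : ℕ → R) (m k : ℕ) : prodSeg x m (k + 1) = x (m + k) * prodSeg x m k := rfl

/-- `prodDesc x 1 = x_0` («Q_1(U′U) = Q(U′U)»). [folklore] -/
theorem prodDesc_one (x : ℕ → R) : prodDesc x 1 = x 0 := by simp

/-- A one-factor segment. [folklore] -/
theorem prodSeg_one (x : ℕ → R) (m : ℕ) : prodSeg x m 1 = x m := by simp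

/-- A segment starting at level `0` is a descending product. [folklore] -/
theorem prodSeg_zero_left (x : ℕ → R) (k : ℕ) : prodSeg x 0 k = prodDesc x k := by
  induction k with
  | zero => rfl
  | succ k ih => simp [ih]

/-- Splitting a descending product at level `m`: `x_{m+k−1}⋯x_0 = (x_{m+k−1}⋯x_m)(x_{m−1}⋯x_0)`. [folklore] -/
theorem prodDesc_add (x : ℕ → R) (m k : ℕ) : prodDesc x (m + k) = prodSeg x m k * prodDesc x m := by
  induction k with
  | zero => simp
  | succ k ih => rw [← add_assoc, prodDesc_succ, ih, prodSeg_succ, mul_assoc]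

/-- Concatenation of segments. [folklore] -/
theorem prodSeg_add (x : ℕ → R) (m k l : ℕ) : prodSeg x m (k + l) = prodSeg x (m + k) l * prodSeg x m k := by
  induction l with
  | zero => simp
  | succ l ih => rw [← add_assoc, prodSeg_succ, ih, prodSeg_succ, mul_assoc, add_assoc]

/-- Constant factors: `prodDesc (fun _ ↦ q) j = q ^ j`. [folklore] -/
theorem prodDesc_const (q : R) (j : ℕ) : prodDesc (fun _ => q) j = q ^ j := by
  induction j with
  | zero => simp
  | succ j ih => rw [prodDesc_succ, ih, pow_succ']

/-- `prodAsc y j = y_0 · y_1 · … · y_{j−1}` (ascending; the shape of the adjoint products «Q*_j(U′U)»). [folklore] -/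
def prodAsc (y : ℕ → R) : ℕ → R
  | 0 => 1
  | j + 1 => prodAsc y j * y j

/-- `prodSegAsc y m k = y_m · y_{m+1} · … · y_{m+k−1}`. [folklore] -/
def prodSegAsc (y : ℕ → R) (m : ℕ) : ℕ → R
  | 0 => 1
  | k + 1 => prodSegAsc y m k * y (m + k)

/-- Empty ascending product. [folklore] -/
@[simp] theorem prodAsc_zero (y : ℕ → R) : prodAsc y 0 = 1 := rfl

/-- One more level on the right: `(y_0⋯y_{j−1}) · y_j`. [folklore] -/
@[simp] theorem prodAsc_succ (y : ℕ → R) (j : ℕ) : prodAsc y (j + 1) = prodAsc y j * y j := rfl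

/-- Empty ascending segment. [folklore] -/
@[simp] theorem prodSegAsc_zero (y : ℕ → R) (m : ℕ) : prodSegAsc y m 0 = 1 := rfl

/-- One more level on the right of an ascending segment. [folklore] -/
@[simp] theorem prodSegAsc_succ (y : ℕ → R) (m k : ℕ) :
    prodSegAsc y m (k + 1) = prodSegAsc y m k * y (m + k) := rfl

/-- An ascending segment from level `0` is an ascending product. [folklore] -/
theorem prodSegAsc_zero_left (y : ℕ → R) (k : ℕ) : prodSegAsc y 0 k = prodAsc y k := by
  induction k with
  | zero => rfl
  | succ k ih => simp [ih]

/-- Splitting an ascending product at level `m`. [folklore] -/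
theorem prodAsc_add (y : ℕ → R) (m k : ℕ) : prodAsc y (m + k) = prodAsc y m * prodSegAsc y m k := by
  induction k with
  | zero => simp
  | succ k ih => rw [← add_assoc, prodAsc_succ, ih, prodSegAsc_succ, mul_assoc]

/-- The ascending product is the descending product read in the opposite monoid (order of factors reversed). [folklore] -/
theorem op_prodDesc (x : ℕ → R) (j : ℕ) :
    MulOpposite.op (prodDesc x j) = prodAsc (fun n => MulOpposite.op (x n)) j := by
  induction j with
  | zero => rfl
  | succ j ih => rw [prodDesc_succ, MulOpposite.op_mul, ih, prodAsc_succ]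

/-- Segments read in the opposite monoid are ascending segments. [folklore] -/
theorem op_prodSeg (x : ℕ → R) (m k : ℕ) :
    MulOpposite.op (prodSeg x m k) = prodSegAsc (fun n => MulOpposite.op (x n)) m k := by
  induction k with
  | zero => rfl
  | succ k ih => rw [prodSeg_succ, MulOpposite.op_mul, ih, prodSegAsc_succ]

end Products

/-! ## §2 The telescoping identity: (3.78) ⟹ (3.80) -/

section Telescope

variable {R : Type*} [Semiring R]

/-- The telescoping sum of (3.80), `F_{2,j}(A)` made explicit:
`teleSum a f x j = Σ_{n<j} (a_{j−1}⋯a_{n+1}) · f_n · (x_{n−1}⋯x_0)` — prefix `prodSeg a (n+1) (j−1−n)`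
(«Q(Ū^{j−1})·…·Q(Ū^{n+1})» = `Q_{j−1−n}(Ū^{n+1})`), the inserted difference `f n` («F₂(B_n)»), suffix
`prodDesc x n` («Q(Ũ′^{n−1}Ū^{n−1})·…·Q(U′U)», `n` FACTORS, i.e. `Q_n(U′U)`). [folklore] [cite: Balaban1985BackgroundPropagators, (3.80) p.406] -/
def teleSum (a f x : ℕ → R) (j : ℕ) : R :=
  ∑ n ∈ range j, prodSeg a (n + 1) (j - 1 - n) * f n * prodDesc x n

/-- No levels, no telescoping terms. [folklore] -/
@[simp] theorem teleSum_zero (a f x : ℕ → R) : teleSum a f x 0 = 0 := by simp [teleSum]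

/-- One more level: the old terms acquire the factor `a_j` on the left, and the new term is `f_j · (x_{j−1}⋯x_0)`. [folklore] [cite: Balaban1985BackgroundPropagators, (3.80) p.406] -/
theorem teleSum_succ (a f x : ℕ → R) (j : ℕ) :
    teleSum a f x (j + 1) = a j * teleSum a f x j + f j * prodDesc x j := by
  unfold teleSum
  rw [sum_range_succ, mul_sum]
  congr 1
  · refine sum_congr rfl fun n hn => ?_
    have hn' : n < j := mem_range.mp hn
    have h1 : j + 1 - 1 - n = (j - 1 - n) + 1 := by omega
    have h2 : n + 1 + (j - 1 - n) = j := by omega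
    rw [h1, prodSeg_succ, h2, mul_assoc, mul_assoc, mul_assoc]
  · have h3 : j + 1 - 1 - j = 0 := by omega
    rw [h3, prodSeg_zero, one_mul]

/-- **(3.78) ⟹ (3.80), the telescoping identity.**  If every factor splits as `x_n = a_n + f_n`
(«Q(exp iB_nŪ^n) = Q(Ū^n) + F₂(B_n)»), then
`x_{j−1}⋯x_0 = a_{j−1}⋯a_0 + Σ_{n<j} (a_{j−1}⋯a_{n+1}) f_n (x_{n−1}⋯x_0)`
(«Q_j(U′U) = Q_j(U) + Σ_{n=0}^{j−1} Q_{j−1−n}(Ū^{n+1})F₂(B_n)Q_n(U′U)» — with `Q_n`, `n` factors, in the last slot). [folklore] [cite: Balaban1985BackgroundPropagators, (3.80) p.406] -/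
theorem prodDesc_telescope (a f x : ℕ → R) (hx : ∀ n, x n = a n + f n) (j : ℕ) :
    prodDesc x j = prodDesc a j + teleSum a f x j := by
  induction j with
  | zero => simp
  | succ j ih =>
    rw [prodDesc_succ, prodDesc_succ, teleSum_succ, hx j, ih]
    simp only [add_mul, mul_add]
    abel

/-- The same with the splitting written as `x = a + f`. [folklore] [cite: Balaban1985BackgroundPropagators, (3.80) p.406] -/
theorem prodDesc_add_telescope (a f : ℕ → R) (j : ℕ) :
    prodDesc (a + f) j = prodDesc a j + teleSum a f (a + f) j :=
  prodDesc_telescope a f (a + f) (fun _ => rfl) j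

end Telescope

section TelescopeRing

variable {R : Type*} [Ring R]

/-- «where F_{2,j} is defined by the last equality»: `F_{2,j} := Q_j(U′U) − Q_j(U)`. [folklore] [cite: Balaban1985BackgroundPropagators, (3.80) p.406] -/
def bigF (a x : ℕ → R) (j : ℕ) : R := prodDesc x j - prodDesc a j

/-- With `f_n := x_n − a_n` («F₂(B) := Q(exp iBV) − Q(V)») no hypothesis is needed:
`Q_j(U′U) − Q_j(U) = Σ_{n<j} Q_{j−1−n}(Ū^{n+1}) F₂(B_n) Q_n(U′U)`. [folklore] [cite: Balaban1985BackgroundPropagators, (3.80) p.406] -/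
theorem bigF_eq_teleSum (a x : ℕ → R) (j : ℕ) : bigF a x j = teleSum a (x - a) x j := by
  have h := prodDesc_telescope a (x - a) x (fun n => by simp) j
  rw [bigF, h]; abel

/-- (3.80), last equality: `Q_j(U′U) = Q_j(U) + F_{2,j}(A)` with `F_{2,j} := Q_j(U′U) − Q_j(U)` (a definition, as the print says). [folklore] [cite: Balaban1985BackgroundPropagators, (3.80) p.406] -/
theorem prodDesc_eq_add_bigF (a x : ℕ → R) (j : ℕ) : prodDesc x j = prodDesc a j + bigF a x j := by
  rw [bigF]; abel

/-- THE PRINTED LAST SLOT READ LITERALLY — `Q_{n−1}(U′U)`, `n − 1` factors (truncated at `n = 0`, where the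
print would read `Q_{−1}`) — gives a DIFFERENT sum: [folklore] [cite: Balaban1985BackgroundPropagators, (3.80) p.406] -/
def teleSumPrinted (a f x : ℕ → R) (j : ℕ) : R :=
  ∑ n ∈ range j, prodSeg a (n + 1) (j - 1 - n) * f n * prodDesc x (n - 1)

/-- … and with that reading (3.80) is FALSE already for `j = 2` over `ℤ` (`a = (2, 0, …)`, `f = (0, 1, 0, …)`,
`x = a + f`: `x_1x_0 = 2`, `a_1a_0 = 0`, correct sum `= f_1·x_0 = 2`, literal sum `= f_1·1 = 1`).  Kernel
confirmation of the index slip recorded in GAPS G-adv8-5 (ii); the displayed bound (3.81) is unaffected. [folklore] [cite: Balaban1985BackgroundPropagators, (3.81) p.406] -/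
theorem telescope_printed_index_fails :
    ∃ a f : ℕ → ℤ, prodDesc (a + f) 2 ≠ prodDesc a 2 + teleSumPrinted a f (a + f) 2 := by
  refine ⟨fun n => if n = 0 then 2 else 0, fun n => if n = 1 then 1 else 0, ?_⟩
  simp [teleSumPrinted, prodDesc]

/-- The same integer instance with all four numbers: product `2`, unperturbed product `0`, telescoping sum with `n`-factor suffixes `2` (correct), with `n−1`-factor suffixes `1` (the literal print). [folklore] [cite: Balaban1985BackgroundPropagators, (3.80) p.406] -/
theorem telescope_correct_index_example :
    let a : ℕ → ℤ := fun n => if n = 0 then 2 else 0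
    let f : ℕ → ℤ := fun n => if n = 1 then 1 else 0
    prodDesc (a + f) 2 = 2 ∧ prodDesc a 2 = 0 ∧ teleSum a f (a + f) 2 = 2 ∧ teleSumPrinted a f (a + f) 2 = 1 := by
  simp [teleSum, teleSumPrinted, prodDesc]

end TelescopeRing

/-! ## §3 The ascending twin: «Q*_j(U′U) = Q*_j(U) + F*_{2,j}(A)» -/

section Ascending

variable {R : Type*} [Semiring R]

/-- `teleSumAsc b g y j = Σ_{n<j} (y_0⋯y_{n−1}) · g_n · (b_{n+1}⋯b_{j−1})` — the reversed-order telescoping sum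
(adjoints reverse products: `(Q_j(U′U))* = Q(U′U)*Q(\overline{U′U})*⋯`). [folklore] [cite: Balaban1985BackgroundPropagators, (3.80) p.406] -/
def teleSumAsc (b g y : ℕ → R) (j : ℕ) : R :=
  ∑ n ∈ range j, prodAsc y n * g n * prodSegAsc b (n + 1) (j - 1 - n)

/-- One more level in the ascending telescoping sum: old terms acquire `b_j` on the right, the new term is `(y_0⋯y_{j−1}) · g_j`. [folklore] -/
theorem teleSumAsc_succ (b g y : ℕ → R) (j : ℕ) :
    teleSumAsc b g y (j + 1) = teleSumAsc b g y j * b j + prodAsc y j * g j := by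
  unfold teleSumAsc
  rw [sum_range_succ, sum_mul]
  congr 1
  · refine sum_congr rfl fun n hn => ?_
    have hn' : n < j := mem_range.mp hn
    have h1 : j + 1 - 1 - n = (j - 1 - n) + 1 := by omega
    have h2 : n + 1 + (j - 1 - n) = j := by omega
    rw [h1, prodSegAsc_succ, h2]
    simp only [mul_assoc]
  · have h3 : j + 1 - 1 - j = 0 := by omega
    rw [h3, prodSegAsc_zero, mul_one]

/-- The ascending telescoping identity: `y_n = b_n + g_n` for all `n` implies
`y_0⋯y_{j−1} = b_0⋯b_{j−1} + Σ_{n<j} (y_0⋯y_{n−1}) g_n (b_{n+1}⋯b_{j−1})`. [folklore] [cite: Balaban1985BackgroundPropagators, (3.80) p.406] -/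
theorem prodAsc_telescope (b g y : ℕ → R) (hy : ∀ n, y n = b n + g n) (j : ℕ) :
    prodAsc y j = prodAsc b j + teleSumAsc b g y j := by
  induction j with
  | zero => simp [teleSumAsc]
  | succ j ih =>
    rw [prodAsc_succ, prodAsc_succ, teleSumAsc_succ, hy j, ih]
    simp only [add_mul, mul_add]
    abel

end Ascending

section Star

variable {R : Type*} [Semiring R] [StarRing R]

/-- Adjoints reverse descending products: `(x_{j−1}⋯x_0)* = x_0*⋯x_{j−1}*`. [folklore] -/
theorem star_prodDesc (x : ℕ → R) (j : ℕ) : star (prodDesc x j) = prodAsc (fun n => star (x n)) j := by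
  induction j with
  | zero => simp
  | succ j ih => rw [prodDesc_succ, star_mul, ih, prodAsc_succ]

/-- Adjoints reverse segments. [folklore] -/
theorem star_prodSeg (x : ℕ → R) (m k : ℕ) :
    star (prodSeg x m k) = prodSegAsc (fun n => star (x n)) m k := by
  induction k with
  | zero => simp
  | succ k ih => rw [prodSeg_succ, star_mul, ih, prodSegAsc_succ]

/-- Adjoints reverse ascending products. [folklore] -/
theorem star_prodAsc (y : ℕ → R) (j : ℕ) : star (prodAsc y j) = prodDesc (fun n => star (y n)) j := by
  induction j with
  | zero => simp
  | succ j ih => rw [prodAsc_succ, star_mul, ih, prodDesc_succ]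

/-- The adjoint of the telescoping sum is the ascending telescoping sum of the adjoints:
`(F_{2,j})* = Σ_{n<j} Q_n(U′U)* F₂(B_n)* Q_{j−1−n}(Ū^{n+1})*`.  (For self-adjoint-type data this is the print's
«similar expansion for Q*_j(U′U)»; the print warns that for complex `A` «F*_{2,j}(A) is not the adjoint of
F_{2,j}(A)» — there the ascending identity `prodAsc_telescope` is applied to the factors `Q*` directly.) [folklore] [cite: Balaban1985BackgroundPropagators, (3.80) p.406] -/
theorem star_teleSum (a f x : ℕ → R) (j : ℕ) :
    star (teleSum a f x j) = teleSumAsc (fun n => star (a n)) (fun n => star (f n)) (fun n => star (x n)) j := by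
  unfold teleSum teleSumAsc
  rw [star_sum]
  refine sum_congr rfl fun n _ => ?_
  rw [star_mul, star_mul, star_prodDesc, star_prodSeg, mul_assoc]

end Star

/-! ## §4 (3.81): the norm bound -/

section Bounds

variable {R : Type*} [NormedRing R]

/-- Submultiplicativity along a descending product: uniform factor bound `‖x_n‖ ≤ q` gives `‖x_{j−1}⋯x_0‖ ≤ q^j`
(for `j ≥ 1`; no `‖1‖ = 1` is assumed). [folklore] [cite: Balaban1985BackgroundPropagators, (3.81) p.406] -/
theorem norm_prodDesc_succ_le (x : ℕ → R) (q : ℝ) (hq : ∀ n, ‖x n‖ ≤ q) (j : ℕ) :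
    ‖prodDesc x (j + 1)‖ ≤ q ^ (j + 1) := by
  induction j with
  | zero => simpa [prodDesc_one] using hq 0
  | succ j ih =>
    rw [prodDesc_succ, pow_succ']
    exact (norm_mul_le _ _).trans (mul_le_mul (hq _) ih (norm_nonneg _) ((norm_nonneg _).trans (hq 0)))

/-- **(3.81), first inequality**, from per-factor bounds: prefixes `‖a_{j−1}⋯a_{n+1}‖ ≤ p_n` («Q″_{j−1−n}»),
insertions `‖f_n‖ ≤ c₀·β_n·Q″` ((3.79) as an operator-norm bound, `sup |B_n| ≤ β_n`), suffixes
`‖x_{n−1}⋯x_0‖ ≤ s_n` («Q″_n», `n` factors):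
`‖F_{2,j}‖ ≤ Σ_{n<j} p_n (c₀ β_n Q″) s_n`. [folklore] [cite: Balaban1985BackgroundPropagators, (3.81) p.406] -/
theorem norm_teleSum_le (a f x : ℕ → R) (j : ℕ) (p β s : ℕ → ℝ) (c₀ Q'' : ℝ)
    (hp : ∀ n < j, ‖prodSeg a (n + 1) (j - 1 - n)‖ ≤ p n) (hf : ∀ n < j, ‖f n‖ ≤ c₀ * β n * Q'')
    (hs : ∀ n < j, ‖prodDesc x n‖ ≤ s n) :
    ‖teleSum a f x j‖ ≤ ∑ n ∈ range j, p n * (c₀ * β n * Q'') * s n := by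
  unfold teleSum
  refine (norm_sum_le _ _).trans (sum_le_sum fun n hn => ?_)
  have hn : n < j := mem_range.mp hn
  have h12 : ‖prodSeg a (n + 1) (j - 1 - n) * f n‖ ≤ p n * (c₀ * β n * Q'') :=
    (norm_mul_le _ _).trans (mul_le_mul (hp n hn) (hf n hn) (norm_nonneg _) ((norm_nonneg _).trans (hp n hn)))
  exact (norm_mul_le _ _).trans
    (mul_le_mul h12 (hs n hn) (norm_nonneg _) ((norm_nonneg _).trans h12))

/-- **(3.81), the printed conclusion** `‖F_{2,j}‖ ≤ O(1)α₁Q″_j` with `O(1) = c₀c₁c₂/(L − 1)`: the fluctuation sizes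
`β_n ≤ c₁α₁L^nL^{−j}` («|B_n| < O(1)α₁L^nξ, ξ = L^{−j}»), the (142)-type merge of majorants `p_n·Q″·s_n ≤ c₂·Q_j`
uniformly in `n`, and the scale sum `Σ_{n<j} L^n/L^j ≤ 1/(L − 1)` (`B9.eq381_scale_sum`, C-B9-9, BY NAME). [folklore] [cite: Balaban1985BackgroundPropagators, (3.81) p.406] -/
theorem norm_teleSum_le_printed (a f x : ℕ → R) (j : ℕ) (p β s : ℕ → ℝ) (c₀ c₁ c₂ Q'' Qj α₁ L : ℝ)
    (hL : 1 < L) (hc₀ : 0 ≤ c₀) (hc₁ : 0 ≤ c₁) (hc₂ : 0 ≤ c₂) (hQ'' : 0 ≤ Q'') (hQj : 0 ≤ Qj) (hα : 0 ≤ α₁)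
    (hp : ∀ n < j, ‖prodSeg a (n + 1) (j - 1 - n)‖ ≤ p n) (hf : ∀ n < j, ‖f n‖ ≤ c₀ * β n * Q'')
    (hs : ∀ n < j, ‖prodDesc x n‖ ≤ s n) (hβ0 : ∀ n < j, 0 ≤ β n)
    (hβ : ∀ n < j, β n ≤ c₁ * α₁ * (L ^ n / L ^ j)) (hmerge : ∀ n < j, p n * Q'' * s n ≤ c₂ * Qj) :
    ‖teleSum a f x j‖ ≤ c₀ * c₁ * c₂ * α₁ * Qj / (L - 1) := by
  refine (norm_teleSum_le a f x j p β s c₀ Q'' hp hf hs).trans ?_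
  have hterm : ∀ n ∈ range j,
      p n * (c₀ * β n * Q'') * s n ≤ (c₀ * c₁ * c₂ * α₁ * Qj) * (L ^ n / L ^ j) := by
    intro n hn
    have hn : n < j := mem_range.mp hn
    have hpn : 0 ≤ p n := (norm_nonneg _).trans (hp n hn)
    have hsn : 0 ≤ s n := (norm_nonneg _).trans (hs n hn)
    have hpqs : 0 ≤ p n * Q'' * s n := by positivity
    calc p n * (c₀ * β n * Q'') * s n = c₀ * β n * (p n * Q'' * s n) := by ring
      _ ≤ c₀ * (c₁ * α₁ * (L ^ n / L ^ j)) * (c₂ * Qj) := by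
          refine mul_le_mul (mul_le_mul_of_nonneg_left (hβ n hn) hc₀) (hmerge n hn) hpqs ?_
          exact mul_nonneg hc₀ ((hβ0 n hn).trans (hβ n hn))
      _ = (c₀ * c₁ * c₂ * α₁ * Qj) * (L ^ n / L ^ j) := by ring
  refine (sum_le_sum hterm).trans ?_
  rw [← mul_sum]
  have hK : 0 ≤ c₀ * c₁ * c₂ * α₁ * Qj := by positivity
  calc (c₀ * c₁ * c₂ * α₁ * Qj) * ∑ n ∈ range j, L ^ n / L ^ j
      ≤ (c₀ * c₁ * c₂ * α₁ * Qj) * (1 / (L - 1)) :=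
        mul_le_mul_of_nonneg_left (B9.eq381_scale_sum L hL j) hK
    _ = c₀ * c₁ * c₂ * α₁ * Qj / (L - 1) := by ring

end Bounds

/-! ## §5 The operator reading: continuous linear operators on a normed space -/

section Operators

variable {𝕜 : Type*} [NontriviallyNormedField 𝕜] {E : Type*} [NormedAddCommGroup E] [NormedSpace 𝕜 E]

/-- (3.80) APPLIED to a field `A′`: `Q_j(U′U)A′ = Q_j(U)A′ + F_{2,j}(A)A′` for continuous linear operators. [folklore] [cite: Balaban1985BackgroundPropagators, (3.80) p.406] -/
theorem prodDesc_telescope_apply (a f x : ℕ → E →L[𝕜] E) (hx : ∀ n, x n = a n + f n) (j : ℕ) (v : E) :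
    prodDesc x j v = prodDesc a j v + teleSum a f x j v := by
  rw [prodDesc_telescope a f x hx j]
  rfl

/-- (3.81) IN THE PRINTED VECTOR FORM `|F_{2,j}(A)A′| ≤ O(1)α₁Q″_j|A′|`. [folklore] [cite: Balaban1985BackgroundPropagators, (3.81) p.406] -/
theorem norm_teleSum_apply_le_printed (a f x : ℕ → E →L[𝕜] E) (j : ℕ) (p β s : ℕ → ℝ)
    (c₀ c₁ c₂ Q'' Qj α₁ L : ℝ)
    (hL : 1 < L) (hc₀ : 0 ≤ c₀) (hc₁ : 0 ≤ c₁) (hc₂ : 0 ≤ c₂) (hQ'' : 0 ≤ Q'') (hQj : 0 ≤ Qj) (hα : 0 ≤ α₁)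
    (hp : ∀ n < j, ‖prodSeg a (n + 1) (j - 1 - n)‖ ≤ p n) (hf : ∀ n < j, ‖f n‖ ≤ c₀ * β n * Q'')
    (hs : ∀ n < j, ‖prodDesc x n‖ ≤ s n) (hβ0 : ∀ n < j, 0 ≤ β n)
    (hβ : ∀ n < j, β n ≤ c₁ * α₁ * (L ^ n / L ^ j)) (hmerge : ∀ n < j, p n * Q'' * s n ≤ c₂ * Qj) (v : E) :
    ‖teleSum a f x j v‖ ≤ c₀ * c₁ * c₂ * α₁ * Qj / (L - 1) * ‖v‖ :=
  (teleSum a f x j).le_of_opNorm_le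
    (norm_teleSum_le_printed a f x j p β s c₀ c₁ c₂ Q'' Qj α₁ L hL hc₀ hc₁ hc₂ hQ'' hQj hα hp hf hs hβ0 hβ hmerge) v

end Operators

/-! ## §6 Sanity -/

section Examples

/-- `j = 3`: `x_2x_1x_0 = a_2a_1a_0 + a_2a_1·f_0 + a_2·f_1·x_0 + f_2·x_1x_0`. -/
example {R : Type*} [Ring R] (a f x : ℕ → R) (hx : ∀ n, x n = a n + f n) :
    x 2 * (x 1 * x 0) = a 2 * (a 1 * a 0) + (a 2 * a 1 * f 0 + a 2 * f 1 * x 0 + f 2 * (x 1 * x 0)) := by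
  have h := prodDesc_telescope a f x hx 3
  simp [teleSum, sum_range_succ, prodDesc, prodSeg] at h
  simpa [mul_assoc] using h

example : prodDesc (fun n : ℕ => (n : ℤ) + 1) 4 = 24 := by norm_num [prodDesc]

end Examples

end Literature.MathematicalPhysics.QuantumFieldTheory.Balaban1983to89.B9Eq380Telescope
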